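import Summits.HubbardSuperconductivity.HubbardSuperconductivity.Theorems.NoGoNogoSingletPairKillsSaturatedFM
import Literature.MathematicalPhysics.QuantumLattice.PairFieldMomentum

/-!
# Crux `WindowInfraredBound` (item `stmt-HubbardSuperconductivity-1089`): no counterexample in a saturated ferromagnet

Negative-side small-model fact of the standing disprover (cdisprove cycle 1).  Route NoGo proved that every
singlet pair operator annihilates a saturated ferromagnet (`NoGo.localPair_mulVec_eq_zero_of_saturated`,
Tasaki 1998 p. 20).  Mode by mode this gives `pairFieldAt_mulVec_eq_zero_of_saturated` (`Δ_g(m) ψ = 0`),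
`pairStructureFactor_eq_zero_of_saturated` (`S_ψ ≡ 0`) and `windowSum_eq_zero_of_saturated`: the window
tail of the crux VANISHES along any `N`-particle state of maximal total spin — in particular along the
`S^z = 0` member of a saturated (Nagaoka-type) sector ground-state multiplet.  So the large-`U`, small-`δ`
corner where finite-density ferromagnetism is conjectured cannot host a counterexample to
`WindowInfraredBound`; a refutation needs a PAIRED inhomogeneous ground state (phase separation with a
superconducting component, or a pair-density wave with `|Q| → 0`), for which no rigorous control exists.
Workfile: `Cruxes/WindowInfraredBound/Disproof.lean`.
-/

noncomputable section

namespace Summit.HubbardSuperconductivity.HubbardSuperconductivity.Theorems.WindowInfraredBound.Negative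

open Literature.MathematicalPhysics.QuantumLattice Literature.Probability.LatticeModels Matrix Finset
open scoped ComplexOrder

variable (g : Site 2 → ℝ) (L : ℕ) [NeZero L]

/-- **Every pair Fourier mode annihilates a saturated ferromagnet**: `Δ_g(m) ψ = 0` for an `N`-particle
`ψ` with `S² ψ = (N/2)(N/2+1) ψ` (the `SU(2)` selection rule of route NoGo, crux 5, mode by mode).
Tasaki, Prog. Theor. Phys. 99 (1998) 489, p. 20. [folklore] -/
theorem pairFieldAt_mulVec_eq_zero_of_saturated (m : TorusSite 2 L) {N : ℕ}
    {ψ : Fock (Orb (FermionTorus 2 L))} (hN : IsNParticle N ψ)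
    (hS : spinSq *ᵥ ψ = (((N : ℝ) / 2 * ((N : ℝ) / 2 + 1) : ℝ) : ℂ) • ψ) :
    pairFieldAt g L m *ᵥ ψ = 0 := by
  rw [pairFieldAt_def, Matrix.sum_mulVec]
  refine Finset.sum_eq_zero fun x _ => ?_
  rw [Matrix.smul_mulVec,
    Summit.HubbardSuperconductivity.NoGo.localPair_mulVec_eq_zero_of_saturated g L x hN hS, smul_zero]

/-- Hence the pair structure factor of a saturated ferromagnet vanishes at EVERY momentum. [folklore] -/
theorem pairStructureFactor_eq_zero_of_saturated (m : TorusSite 2 L) {N : ℕ}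
    {ψ : Fock (Orb (FermionTorus 2 L))} (hN : IsNParticle N ψ)
    (hS : spinSq *ᵥ ψ = (((N : ℝ) / 2 * ((N : ℝ) / 2 + 1) : ℝ) : ℂ) • ψ) :
    pairStructureFactor g L ψ m = 0 := by
  rw [pairStructureFactor_apply, pairFieldAt_mulVec_eq_zero_of_saturated g L m hN hS]
  simp

/-- **No counterexample to `WindowInfraredBound` lives in a saturated-ferromagnetic (Nagaoka) phase**:
along any `N`-particle state of maximal total spin — in particular the `S^z = 0` member of a saturated
sector ground-state multiplet — the window tail of the crux is `0 ≤ C ε L²` for every `C ≥ 0`.  So the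
large-`U`, small-`δ` corner is harmless for the crux exactly where route NoGo hopes for ferromagnetism;
a refutation needs a PAIRED inhomogeneous state (phase separation with a superconducting component, or a
pair-density wave with `|Q| → 0`). Tasaki, Prog. Theor. Phys. 99 (1998) 489, p. 20–21. [folklore] -/
theorem windowSum_eq_zero_of_saturated (ε : ℝ) {N : ℕ} {ψ : Fock (Orb (FermionTorus 2 L))}
    (hN : IsNParticle N ψ) (hS : spinSq *ᵥ ψ = (((N : ℝ) / 2 * ((N : ℝ) / 2 + 1) : ℝ) : ℂ) • ψ) :
    (∑ m : TorusSite 2 L, if m ≠ 0 ∧ momentumNormSq L m ≤ ε ^ 2 then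
        pairStructureFactor dWaveFormFactor L ψ m else 0) = 0 :=
  Finset.sum_eq_zero fun m _ => by
    rw [pairStructureFactor_eq_zero_of_saturated dWaveFormFactor L m hN hS, ite_self]

end Summit.HubbardSuperconductivity.HubbardSuperconductivity.Theorems.WindowInfraredBound.Negative

end
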